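import Mathlib.LinearAlgebra.FiniteDimensional.Lemmas
import Mathlib.LinearAlgebra.Dimension.StrongRankCondition
import Mathlib.LinearAlgebra.Basis.Basic
import Mathlib.LinearAlgebra.Quotient.Basic
import Mathlib.SetTheory.Cardinal.Finite
import Mathlib.Data.Real.Basic
import HarnessLib

/-!
# The weak Morse inequality of algebraic discrete Morse theory (based chain complexes)

R. Forman, *Morse theory for cell complexes*, Adv. Math. 134 (1998), §8, proof of Cor. 8.3
(p. 124): once the cellular chain complex of `M` with coefficients in a field `F` is compared
with a complex `𝓜 ⊗ F` having `dim_F 𝓜_p ⊗ F = m_p(f)`, the Morse inequalities "follow from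
standard linear algebra"; D. Kozlov, *Combinatorial algebraic topology* (2008), §11.3,
Def. 11.22 and Thm. 11.24 (main theorem of algebraic Morse theory: a based free chain complex
with an acyclic matching whose matched covering weights are invertible is the direct sum of its
Morse complex, free on the critical basis elements, and an acyclic complex — so that over a
field `dim H_n ≤ #(critical basis elements of dimension n)`); K. Knudson, *Morse theory: smooth
and discrete* (2015), §9.4, Thm. 9.28 / Cor. 9.29.

This file PROVES the weak Morse inequality in that algebraic setting, for the matching coming
from a discrete Morse FUNCTION (values `f` on the cells, Forman's Def. 2.1 read with
"`σ` is a facet of `τ`" meaning "the incidence coefficient `[τ : σ]` is nonzero"), by an argument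
that needs neither the Morse complex nor `∂ ∘ ∂ = 0`:

* `linearIndependent_of_triangular` — a family `x : ι → M` admitting functionals `ψ i` with
  `ψ i (x i) ≠ 0` and `ψ i (x j) ≠ 0 ⇒ i = j ∨ g i < g j` for some real "potential" `g` is
  linearly independent (a triangular matrix with nonzero diagonal is invertible);
* for three consecutive terms `C₂ →d₂→ C₁ →d₁→ C₀` of a complex of vector spaces over a division
  ring `F`, a basis `b₁` of `C₁` indexed by the finite type `K₁` of "`p`-cells", `(p+1)`-cells
  `e₂ : K₂ → C₂`, coordinate functionals `φ₀ : K₀ → (C₀ →ₗ F)` of the `(p-1)`-cells and values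
  `f₀, f₁, f₂` (§1, `upInc`/`downInc` are the incidences `[τ : σ] = b₁.repr (d₂ (e₂ τ)) σ` and
  `[σ : ν] = φ₀ ν (d₁ (b₁ σ))`): under Forman's condition (ii) at the `(p+1)`-cells
  (`IsUpMorse`: each `τ` has at most one facet `σ` with `f₂ τ ≤ f₁ σ`) the boundaries of the
  cofacet partners of the up-paired `p`-cells are linearly independent, so
  **`#(up-paired p-cells) ≤ rank d₂`** (`card_upPaired_le_finrank_range`), and dually under
  condition (i) at the `(p-1)`-cells **`#(down-paired p-cells) ≤ rank d₁`**
  (`card_downPaired_le_finrank_range`);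
* **`card_le_card_critical_add_finrank_range_add`**: `#K₁ ≤ m_p + rank d₁ + rank d₂`, where
  `m_p` is the number of critical `p`-cells (Def. 2.2: `f` increases strictly to every cofacet and
  decreases strictly to every facet);
* **`finrank_ker_quotient_range_le_card_critical`** — the weak Morse inequality
  **`dim_F (ker d₁ / im d₂) ≤ m_p`** when `im d₂ ⊆ ker d₁` (rank–nullity).

Only conditions (2.1 (ii)) at dimension `p + 1` and (2.1 (i)) at dimension `p - 1` are used, and
Forman's Lemma 2.5 (a cell is not paired both up and down) is not needed for the inequality.
The bridge to `Literature.AlgebraicTopology.DiscreteMorseTheory.IsDiscreteMorseFunction` (cell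
posets, `DiscreteMorseFunction.lean`) is immediate once "facet" is read as "nonzero incidence";
for the cellular chain complex of a finite regular CW complex this reading is Forman's (1.1),
`[τ : σ] = ±1` for `σ⁽ᵖ⁾ < τ⁽ᵖ⁺¹⁾` (p. 98), which is what separates this algebraic statement from
his topological Cor. 3.7 (`Forman1998_weakMorseInequalities`).

## References

* R. Forman, *Morse theory for cell complexes*, Adv. Math. 134 (1998), 90–145, §2 Def. 2.1–2.2,
  §8 Cor. 8.3. [Forman1998]
* D. Kozlov, *Combinatorial algebraic topology*, Springer (2008), §11.3, Def. 11.22, Thm. 11.24.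
  [Kozlov2008]
* K. P. Knudson, *Morse theory: smooth and discrete*, World Scientific (2015), §9.4, Thm. 9.28,
  Cor. 9.29.
-/

noncomputable section

open Function Set Module

namespace Literature.AlgebraicTopology.DiscreteMorseTheory

universe u v w

variable {F : Type u} [DivisionRing F]

/-! ### §0 Triangular families are linearly independent -/

/-- **Triangular independence.** Let `x : ι → M` be a family of vectors, `ψ : ι → (M →ₗ F)`
functionals and `g : ι → ℝ` a "potential" such that `ψ i (x i) ≠ 0` for all `i`, and
`ψ i (x j) ≠ 0` with `i ≠ j` forces `g i < g j`.  Then `x` is linearly independent: in a vanishing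
combination, test against `ψ i₀` for a coefficient-carrying index `i₀` of maximal potential — all
other terms die, so the coefficient of `i₀` vanishes (the matrix `(ψ i (x j))` is triangular with
nonzero diagonal for any order refining `g`). [folklore] -/
theorem linearIndependent_of_triangular {ι : Type v} {M : Type w} [AddCommGroup M] [Module F M]
    (x : ι → M) (ψ : ι → M →ₗ[F] F) (g : ι → ℝ) (hdiag : ∀ i, ψ i (x i) ≠ 0)
    (htri : ∀ i j, ψ i (x j) ≠ 0 → i ≠ j → g i < g j) : LinearIndependent F x := by
  classical
  rw [linearIndependent_iff']
  intro s c hs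
  by_contra! hne
  obtain ⟨i₁, hi₁s, hi₁⟩ := hne
  set T : Finset ι := s.filter fun i => c i ≠ 0 with hT
  have hTne : T.Nonempty := ⟨i₁, Finset.mem_filter.2 ⟨hi₁s, hi₁⟩⟩
  obtain ⟨i₀, hi₀T, hmax⟩ := T.exists_max_image g hTne
  obtain ⟨hi₀s, hi₀⟩ := Finset.mem_filter.1 hi₀T
  -- test the relation against `ψ i₀`
  have h0 : ψ i₀ (∑ i ∈ s, c i • x i) = 0 := by rw [hs, map_zero]
  rw [map_sum] at h0
  simp only [map_smul, smul_eq_mul] at h0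
  rw [Finset.sum_eq_single i₀] at h0
  · exact hi₀ ((mul_eq_zero.1 h0).resolve_right (hdiag i₀))
  · intro j hjs hji
    by_cases hcj : c j = 0
    · rw [hcj, zero_mul]
    · have hjT : j ∈ T := Finset.mem_filter.2 ⟨hjs, hcj⟩
      have hle : g j ≤ g i₀ := hmax j hjT
      by_cases hψ : ψ i₀ (x j) = 0
      · rw [hψ, mul_zero]
      · exact absurd (htri i₀ j hψ (Ne.symm hji)) hle.not_gt
  · intro h
    exact absurd hi₀s h

/-- A linearly independent family with values in a finite-dimensional submodule `N` has at most
`dim N` members. [folklore] -/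
theorem card_le_finrank_of_linearIndependent_of_mem {ι : Type v} [Fintype ι] {M : Type w}
    [AddCommGroup M] [Module F M] (N : Submodule F M) [Module.Finite F N] {x : ι → M}
    (hx : LinearIndependent F x) (hmem : ∀ i, x i ∈ N) : Fintype.card ι ≤ finrank F N := by
  let x' : ι → N := fun i => ⟨x i, hmem i⟩
  have hx' : LinearIndependent F x' := LinearIndependent.of_comp N.subtype (by exact hx)
  exact hx'.fintype_card_le_finrank

/-! ### §1 Three consecutive terms of a based complex with a discrete Morse function -/

section Triple

variable {C₀ : Type v} {C₁ : Type v} {C₂ : Type v} [AddCommGroup C₀] [Module F C₀]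
  [AddCommGroup C₁] [Module F C₁] [AddCommGroup C₂] [Module F C₂]
variable {K₀ K₁ K₂ : Type w}
variable (b₁ : Basis K₁ F C₁) (d₁ : C₁ →ₗ[F] C₀) (d₂ : C₂ →ₗ[F] C₁) (e₂ : K₂ → C₂)
  (φ₀ : K₀ → C₀ →ₗ[F] F)

/-- The incidence coefficient `[τ : σ]` of the `p`-cell `σ` in the boundary of the `(p+1)`-cell
`τ`: the `σ`-coordinate of `d₂ (e₂ τ)` in the basis `b₁` (Forman 1998, §1 (1.1); Kozlov 2008,
§11.3: the covering weight `w(τ ≻ σ) = k_Ω(∂ τ, σ)`). [cite: Kozlov2008, §11.3 (before Def. 11.22)] -/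
def upInc (σ : K₁) (τ : K₂) : F :=
  b₁.repr (d₂ (e₂ τ)) σ

/-- The incidence coefficient `[σ : ν]` of the `(p-1)`-cell `ν` in the boundary of the `p`-cell
`σ`, read through the coordinate functional `φ₀ ν` (Kozlov 2008, §11.3). [cite: Kozlov2008, §11.3 (before Def. 11.22)] -/
def downInc (ν : K₀) (σ : K₁) : F :=
  φ₀ ν (d₁ (b₁ σ))

/-- Forman's condition (ii) of Def. 2.1 at the `(p+1)`-cells, facets read as nonzero incidences:
every `τ⁽ᵖ⁺¹⁾` has at most one facet `σ⁽ᵖ⁾` (`[τ : σ] ≠ 0`) with `f σ ≥ f τ`. [cite: Forman1998, Def. 2.1 (ii)] -/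
def IsUpMorse (f₁ : K₁ → ℝ) (f₂ : K₂ → ℝ) : Prop :=
  ∀ τ : K₂, {σ : K₁ | upInc b₁ d₂ e₂ σ τ ≠ 0 ∧ f₂ τ ≤ f₁ σ}.Subsingleton

/-- Forman's condition (i) of Def. 2.1 at the `(p-1)`-cells, facets read as nonzero incidences:
every `ν⁽ᵖ⁻¹⁾` has at most one cofacet `σ⁽ᵖ⁾` (`[σ : ν] ≠ 0`) with `f σ ≤ f ν`. [cite: Forman1998, Def. 2.1 (i)] -/
def IsDownMorse (f₀ : K₀ → ℝ) (f₁ : K₁ → ℝ) : Prop :=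
  ∀ ν : K₀, {σ : K₁ | downInc b₁ d₁ φ₀ ν σ ≠ 0 ∧ f₁ σ ≤ f₀ ν}.Subsingleton

variable (f₀ : K₀ → ℝ) (f₁ : K₁ → ℝ) (f₂ : K₂ → ℝ)

/-- A `p`-cell `σ` is **critical** (Forman 1998, Def. 2.2, facets read as nonzero incidences):
`f` increases strictly to every cofacet (`[τ : σ] ≠ 0 ⇒ f σ < f τ`) and decreases strictly to
every facet (`[σ : ν] ≠ 0 ⇒ f ν < f σ`). [cite: Forman1998, Def. 2.2] -/
def IsCriticalCell (σ : K₁) : Prop :=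
  (∀ τ, upInc b₁ d₂ e₂ σ τ ≠ 0 → f₁ σ < f₂ τ) ∧ ∀ ν, downInc b₁ d₁ φ₀ ν σ ≠ 0 → f₀ ν < f₁ σ

/-- A `p`-cell is **up-paired** if it has a cofacet `τ` with `f τ ≤ f σ` (Forman 1998, p. 102,
condition (i) for non-criticality; Kozlov's `𝒟_p(Ω)`). [cite: Forman1998, §2 (p. 102)] -/
def IsUpPaired (σ : K₁) : Prop :=
  ∃ τ, upInc b₁ d₂ e₂ σ τ ≠ 0 ∧ f₂ τ ≤ f₁ σ

/-- A `p`-cell is **down-paired** if it has a facet `ν` with `f ν ≥ f σ` (Forman 1998, p. 102,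
condition (ii) for non-criticality; Kozlov's `𝒰_p(Ω)`). [cite: Forman1998, §2 (p. 102)] -/
def IsDownPaired (σ : K₁) : Prop :=
  ∃ ν, downInc b₁ d₁ φ₀ ν σ ≠ 0 ∧ f₁ σ ≤ f₀ ν

variable {b₁ d₁ d₂ e₂ φ₀ f₀ f₁ f₂}

/-- Forman's remark after Def. 2.2 (p. 102): a non-critical cell is up-paired or down-paired.
[cite: Forman1998, §2 (p. 102)] -/
theorem isUpPaired_or_isDownPaired_of_not_isCriticalCell {σ : K₁}
    (h : ¬ IsCriticalCell b₁ d₁ d₂ e₂ φ₀ f₀ f₁ f₂ σ) :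
    IsUpPaired b₁ d₂ e₂ f₁ f₂ σ ∨ IsDownPaired b₁ d₁ φ₀ f₀ f₁ σ := by
  simp only [IsCriticalCell, not_and_or, not_forall, not_lt, exists_prop] at h
  exact h

/-- **Up-paired cells inject into the rank of `d₂`.** Under condition (ii) at the `(p+1)`-cells,
the boundaries `d₂ (e₂ τ_σ)` of the cofacet partners of the up-paired `p`-cells `σ` are linearly
independent (test against the coordinate `σ₀` of maximal `f`-value: `[τ_σ : σ₀] ≠ 0` with
`σ ≠ σ₀` would give `f σ₀ < f τ_σ ≤ f σ` by uniqueness of the facet `σ` of `τ_σ` with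
`f ≥ f τ_σ`), hence `#(up-paired) ≤ dim (im d₂)`. [cite: Kozlov2008, Thm. 11.24] -/
theorem card_upPaired_le_finrank_range [Fintype K₁] (hU : IsUpMorse b₁ d₂ e₂ f₁ f₂) :
    Nat.card {σ : K₁ // IsUpPaired b₁ d₂ e₂ f₁ f₂ σ} ≤ finrank F (LinearMap.range d₂) := by
  classical
  haveI : Module.Finite F C₁ := Module.Finite.of_basis b₁
  set S := {σ : K₁ // IsUpPaired b₁ d₂ e₂ f₁ f₂ σ}
  -- the cofacet partner
  choose u hu using fun σ : S => σ.2
  let x : S → C₁ := fun σ => d₂ (e₂ (u σ))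
  have hx : LinearIndependent F x := by
    refine linearIndependent_of_triangular x (fun σ => b₁.coord σ.1) (fun σ => f₁ σ.1)
      (fun σ => (hu σ).1) ?_
    intro i j hij hne
    -- `i.1` is a facet of `u j` with nonzero incidence
    have hinc : upInc b₁ d₂ e₂ i.1 (u j) ≠ 0 := hij
    by_contra! hle
    -- then `f₂ (u j) ≤ f₁ j ≤ f₁ i`, so both `i.1` and `j.1` are facets of `u j` with `f ≥ f (u j)`
    have hi : i.1 ∈ {σ : K₁ | upInc b₁ d₂ e₂ σ (u j) ≠ 0 ∧ f₂ (u j) ≤ f₁ σ} :=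
      ⟨hinc, (hu j).2.trans hle⟩
    have hj : j.1 ∈ {σ : K₁ | upInc b₁ d₂ e₂ σ (u j) ≠ 0 ∧ f₂ (u j) ≤ f₁ σ} := hu j
    exact hne (Subtype.ext (hU (u j) hi hj))
  rw [Nat.card_eq_fintype_card]
  exact card_le_finrank_of_linearIndependent_of_mem (LinearMap.range d₂) hx
    fun σ => LinearMap.mem_range_self d₂ _

/-- **Down-paired cells inject into the rank of `d₁`.** Under condition (i) at the `(p-1)`-cells,
the boundaries `d₁ (b₁ σ)` of the down-paired `p`-cells are linearly independent (test against
the functional `φ₀ ν_{σ₀}` of the facet partner of the cell `σ₀` of maximal `f`-value), hence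
`#(down-paired) ≤ dim (im d₁)`. [cite: Kozlov2008, Thm. 11.24] -/
theorem card_downPaired_le_finrank_range [Fintype K₁] (hD : IsDownMorse b₁ d₁ φ₀ f₀ f₁) :
    Nat.card {σ : K₁ // IsDownPaired b₁ d₁ φ₀ f₀ f₁ σ} ≤ finrank F (LinearMap.range d₁) := by
  classical
  haveI : Module.Finite F C₁ := Module.Finite.of_basis b₁
  set S := {σ : K₁ // IsDownPaired b₁ d₁ φ₀ f₀ f₁ σ}
  -- the facet partner
  choose w hw using fun σ : S => σ.2
  let x : S → C₀ := fun σ => d₁ (b₁ σ.1)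
  have hx : LinearIndependent F x := by
    refine linearIndependent_of_triangular x (fun σ => φ₀ (w σ)) (fun σ => f₁ σ.1)
      (fun σ => (hw σ).1) ?_
    intro i j hij hne
    have hinc : downInc b₁ d₁ φ₀ (w i) j.1 ≠ 0 := hij
    by_contra! hle
    -- then `f₁ j ≤ f₁ i ≤ f₀ (w i)`, so both `i.1` and `j.1` are cofacets of `w i` with `f ≤ f (w i)`
    have hj : j.1 ∈ {σ : K₁ | downInc b₁ d₁ φ₀ (w i) σ ≠ 0 ∧ f₁ σ ≤ f₀ (w i)} :=
      ⟨hinc, hle.trans (hw i).2⟩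
    have hi : i.1 ∈ {σ : K₁ | downInc b₁ d₁ φ₀ (w i) σ ≠ 0 ∧ f₁ σ ≤ f₀ (w i)} := hw i
    exact hne (Subtype.ext (hD (w i) hi hj))
  rw [Nat.card_eq_fintype_card]
  exact card_le_finrank_of_linearIndependent_of_mem (LinearMap.range d₁) hx
    fun σ => LinearMap.mem_range_self d₁ _

/-- **Cell count.** Under Forman's conditions (ii) at dimension `p + 1` and (i) at dimension
`p - 1`, `#(p-cells) ≤ m_p + rank d₁ + rank d₂`: every cell is critical, up-paired or
down-paired, and the two previous lemmas. [cite: Kozlov2008, Thm. 11.24] -/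
theorem card_le_card_critical_add_finrank_range_add [Fintype K₁]
    (hU : IsUpMorse b₁ d₂ e₂ f₁ f₂) (hD : IsDownMorse b₁ d₁ φ₀ f₀ f₁) :
    Fintype.card K₁ ≤ Nat.card {σ : K₁ // IsCriticalCell b₁ d₁ d₂ e₂ φ₀ f₀ f₁ f₂ σ} +
      finrank F (LinearMap.range d₁) + finrank F (LinearMap.range d₂) := by
  classical
  set A : Finset K₁ := Finset.univ.filter fun σ => IsCriticalCell b₁ d₁ d₂ e₂ φ₀ f₀ f₁ f₂ σ
    with hA
  set B : Finset K₁ := Finset.univ.filter fun σ => IsDownPaired b₁ d₁ φ₀ f₀ f₁ σ with hB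
  set U : Finset K₁ := Finset.univ.filter fun σ => IsUpPaired b₁ d₂ e₂ f₁ f₂ σ with hU'
  have hcover : (Finset.univ : Finset K₁) ⊆ A ∪ B ∪ U := by
    intro σ _
    simp only [hA, hB, hU', Finset.mem_union, Finset.mem_filter, Finset.mem_univ, true_and]
    by_cases h : IsCriticalCell b₁ d₁ d₂ e₂ φ₀ f₀ f₁ f₂ σ
    · exact Or.inl (Or.inl h)
    · rcases isUpPaired_or_isDownPaired_of_not_isCriticalCell h with h' | h'
      · exact Or.inr h'
      · exact Or.inl (Or.inr h')
  have h1 : Fintype.card K₁ ≤ (A ∪ B ∪ U).card := by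
    rw [← Finset.card_univ]
    exact Finset.card_le_card hcover
  have h2 : (A ∪ B ∪ U).card ≤ A.card + B.card + U.card :=
    (Finset.card_union_le (A ∪ B) U).trans (Nat.add_le_add_right (Finset.card_union_le A B) _)
  have hc : A.card = Nat.card {σ : K₁ // IsCriticalCell b₁ d₁ d₂ e₂ φ₀ f₀ f₁ f₂ σ} := by
    rw [Nat.card_eq_fintype_card, Fintype.card_subtype]
  have hd : B.card ≤ finrank F (LinearMap.range d₁) := by
    have := card_downPaired_le_finrank_range (f₀ := f₀) (f₁ := f₁) hD
    rwa [Nat.card_eq_fintype_card, Fintype.card_subtype] at this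
  have hu : U.card ≤ finrank F (LinearMap.range d₂) := by
    have := card_upPaired_le_finrank_range (f₁ := f₁) (f₂ := f₂) hU
    rwa [Nat.card_eq_fintype_card, Fintype.card_subtype] at this
  omega

/-- **The weak Morse inequality `b_p ≤ m_p` of algebraic discrete Morse theory** (Forman 1998,
Cor. 8.3 via "standard linear algebra", p. 124; Kozlov 2008, Thm. 11.24; Knudson 2015,
Cor. 9.29): if moreover `im d₂ ⊆ ker d₁`, then the homology `ker d₁ / im d₂` of the middle term
has dimension at most the number `m_p` of critical `p`-cells (rank–nullity:
`dim H = #K₁ - rank d₁ - rank d₂`). [cite: Kozlov2008, Thm. 11.24] -/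
theorem finrank_ker_quotient_range_le_card_critical [Fintype K₁]
    (hd : LinearMap.range d₂ ≤ LinearMap.ker d₁)
    (hU : IsUpMorse b₁ d₂ e₂ f₁ f₂) (hD : IsDownMorse b₁ d₁ φ₀ f₀ f₁) :
    finrank F (LinearMap.ker d₁ ⧸ (LinearMap.range d₂).comap (LinearMap.ker d₁).subtype) ≤
      Nat.card {σ : K₁ // IsCriticalCell b₁ d₁ d₂ e₂ φ₀ f₀ f₁ f₂ σ} := by
  haveI : Module.Finite F C₁ := Module.Finite.of_basis b₁
  have hmain := card_le_card_critical_add_finrank_range_add hU hD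
  -- rank–nullity for `d₁` and the dimension of `C₁`
  have hrn := LinearMap.finrank_range_add_finrank_ker d₁
  rw [finrank_eq_card_basis b₁] at hrn
  -- the quotient
  have hq := Submodule.finrank_quotient_add_finrank
    ((LinearMap.range d₂).comap (LinearMap.ker d₁).subtype)
  have hcomap : finrank F ((LinearMap.range d₂).comap (LinearMap.ker d₁).subtype) =
      finrank F (LinearMap.range d₂) :=
    LinearEquiv.finrank_eq (Submodule.comapSubtypeEquivOfLe hd)
  omega

end Triple

end Literature.AlgebraicTopology.DiscreteMorseTheory
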